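import Literature.NumberTheory.PAdicHodge.BdRPlusLatticeComplete
import Literature.NumberTheory.PAdicHodge.AinfAdicComplete
import Literature.NumberTheory.PAdicHodge.BdRPlusLogOneAdd
import HarnessLib

/-!
# Fontaine's logarithm `log(1 + y)` for `y ∈ (p, ξ)𝔸_inf`, `p`-ADICALLY, modulo `Fil^k B_dR⁺` — e.g. `log[x]` for `x ∈ 1 + p♭𝒪_{ℂ♭}`

Topic `Literature/NumberTheory/PAdicHodge`; namespace `Literature.NumberTheory.PAdicHodge.GaloisContinuity`. Sequel of
`BdRPlusLatticeComplete` (completeness of `B_dR⁺/Fil^k` for Fontaine's lattices `Λ(N,k) = p^N ι(𝔸_inf) + ξ^k B_dR⁺`) and of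
`BdRPlusLogOneAdd` (the `ξ`-ADIC logarithm on `1 + Fil¹`). For `y ∈ (p, ξ)𝔸_inf` — e.g. `y = [x] − 1` with `x ∈ 1 + p♭𝒪_{ℂ_F}♭`, where
`θ[x] = x♯ ≠ 1` in general, so that `log[x] = Σ (−1)^{n+1} ([x]−1)ⁿ/n` does NOT converge `ξ`-adically — the logarithm series
converges for Fontaine's `p`-adic Banach topology on each `B_dR⁺/Fil^k` (Fontaine, Astérisque 223, Exp. II §1.5.3–1.5.4; this is how
`(B_crys⁺)^{φ=p} ∋ log[x]` is seen inside `B_dR⁺`):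

* `logTerm y n = (−1)^{n+1} ι(y)ⁿ/n`, `logPartialSum y N = Σ_{n=1}^{N} logTerm y n` (definitions);
* `logTerm_mem_lattice` — for `n = p^e n'`, `p ∤ n'`, `k + e ≤ n`: `logTerm y n ∈ Λ(n − k − e, k)` (from `(p,ξ)ⁿ ⊆ p^{n−k}𝔸_inf + ξ^k𝔸_inf`,
  tree `span_p_xi_pow_le`); `logPartialSum_sub_mem_lattice` — the partial sums are lattice-Cauchy: `P_N − P_M ∈ Λ(j, k)` for
  `2(j+k) < M ≤ N` (`v_p(n) ≤ n/2`);
* the predicate `IsLogModFil k y L` («`L ∈ B_dR⁺` is a logarithm of `1 + y` modulo `Fil^k`»: `L − P_M ∈ Λ(j, k)` for `M ≫_j 0`) and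
  ★ `exists_isLogModFil` (existence, by `exists_lim_of_forall_sub_mem_lattice`), ★ `IsLogModFil.sub_mem_span_xiBdR_pow` (uniqueness
  modulo `ξ^k B_dR⁺`), `IsLogModFil.galBdRPlus` (`Γ_F`-equivariance: `σ L` is a logarithm of `1 + σy`), and the consistency
  ★ `isLogModFil_logOneAdd` — on `y ∈ ξ𝔸_inf` the `ξ`-adic logarithm `BdRPlusTop.logOneAdd` IS a logarithm modulo every `Fil^k`.

Floor (H4)-1 of `Summits/…/Cruxes/StarredOptimalManinUnitFiveSeven/Lines/kato-lever-K3-B2-road.md` (crux K★ `stmt-BirchSwinnertonDyer-22226`):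
the generator `log[x] mod Fil²` of the `ℚ_p(1)`-structure `X₂ ⊂ B_dR⁺/Fil²`. Definitions (reviewed): `logTerm`, `logPartialSum`,
`IsLogModFil`. No named fact, no instance, no `sorry`. BSD / K★ are not proved by any of this.

## References
* J.-M. Fontaine, *Le corps des périodes p-adiques*, Astérisque 223 (1994), Exp. II §1.5.3–1.5.4. [FontaineAsterisque223III]
* J.-M. Fontaine, Y. Ouyang, *Theory of p-adic Galois representations*, §5.1.2, §6.1 (`log[x]`, `(B_crys⁺)^{φ=p}`). [FontaineOuyang2022]
-/

noncomputable section

open ValuativeRel Field Ideal WittVector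

namespace Literature.NumberTheory.PAdicHodge

namespace GaloisContinuity

open Literature.NumberTheory.GaloisRepresentations
open Literature.NumberTheory.GaloisRepresentations.IsNonarchimedeanLocalField
open TruncatedLog

variable {F : Type} [Field F] [ValuativeRel F] [TopologicalSpace F] [IsNonarchimedeanLocalField F]
  [CharZero F] {p : ℕ} [Fact p.Prime] [Fact (¬ IsUnit (p : integerC F))]
  [IsAdicComplete (Ideal.span {(p : integerC F)}) (integerC F)]

/-! ## §1 The terms and partial sums of `log(1 + y)` -/

/-- **The `n`-th term `(−1)^{n+1} ι(y)ⁿ/n ∈ B_dR⁺`** of the logarithm series at `y ∈ 𝔸_inf` (`n ≥ 1`; junk `0` at `n = 0`).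
[cite: FontaineAsterisque223III, Exp. II §1.5.4] -/
def logTerm (y : Ainf (p := p) F) (n : ℕ) : BDeRhamPlus (integerC F) p :=
  qpToBdR (((-1 : ℚ_[p]) ^ (n + 1)) / (n : ℚ_[p])) * ainfToBdR y ^ n

/-- **The partial sum `P_N(y) = Σ_{n=1}^{N} (−1)^{n+1} ι(y)ⁿ/n ∈ B_dR⁺`.** [cite: FontaineAsterisque223III, Exp. II §1.5.4] -/
def logPartialSum (y : Ainf (p := p) F) (N : ℕ) : BDeRhamPlus (integerC F) p :=
  ∑ n ∈ Finset.range N, logTerm y (n + 1)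

omit [CharZero F] in
/-- `P_{N+1} = P_N + (N+1)`-st term. [cite: FontaineAsterisque223III, Exp. II §1.5.4] -/
theorem logPartialSum_succ (y : Ainf (p := p) F) (N : ℕ) :
    logPartialSum y (N + 1) = logPartialSum y N + logTerm y (N + 1) := by
  rw [logPartialSum, Finset.sum_range_succ, logPartialSum]

omit [CharZero F] in
/-- `P_N(y) = L_N(ι y)` — the partial sum is the tree's truncated logarithm `logTrunc N` evaluated at `ι(y)`.
[cite: FontaineAsterisque223III, Exp. II §1.5.4] -/
theorem logPartialSum_eq_aeval_logTrunc (y : Ainf (p := p) F) (N : ℕ) :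
    logPartialSum y N = Polynomial.aeval (ainfToBdR y) (logTrunc N) := by
  rw [aeval_logTrunc, logPartialSum]
  refine Finset.sum_congr rfl fun n _ => ?_
  rw [logTerm, algebraMap_rat_bDeRhamPlus]
  congr 2
  rw [map_div₀, map_pow, map_neg, map_one, map_add, map_natCast, map_one]
  push_cast
  ring

/-! ## §2 The terms lie deep in the lattices: `logTerm y n ∈ Λ(n − k − v_p(n), k)` -/

omit [CharZero F] [IsAdicComplete (Ideal.span {(p : integerC F)}) (integerC F)] in
/-- `(p, ξ)ⁿ ⊆ p^{n−k} 𝔸_inf + ξ^k 𝔸_inf` on elements (`k ≤ n`): `y ∈ (p,ξ) ⇒ yⁿ = p^{n−k} b + ξ^k c`.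
[cite: FontaineAsterisque223III, Exp. II §1.3] -/
theorem exists_pow_eq_of_mem_span_p_xi {y : Ainf (p := p) F} (hy : y ∈ Ideal.span {(p : Ainf (p := p) F), xi}) {n k : ℕ}
    (hk : k ≤ n) : ∃ b c : Ainf (p := p) F, y ^ n = (p : Ainf (p := p) F) ^ (n - k) * b + xi ^ k * c := by
  have h1 : y ^ n ∈ Ideal.span {(p : Ainf (p := p) F), xi} ^ ((n - k) + k) := by
    rw [Nat.sub_add_cancel hk]; exact Ideal.pow_mem_pow hy n
  obtain ⟨u, hu, v, hv, huv⟩ := Submodule.mem_sup.1 (span_p_xi_pow_le (n - k) k h1)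
  obtain ⟨b, hb⟩ := Ideal.mem_span_singleton'.1 hu
  obtain ⟨c, hc⟩ := Ideal.mem_span_singleton'.1 hv
  refine ⟨b, c, ?_⟩
  rw [← huv, ← hb, ← hc]; ring

omit [CharZero F] [Fact (¬ IsUnit (p : integerC F))] [IsAdicComplete (Ideal.span {(p : integerC F)}) (integerC F)]
  [ValuativeRel F] [TopologicalSpace F] [IsNonarchimedeanLocalField F] in
/-- `n'` prime to `p` is a unit of `ℤ_p`. [cite: FontaineOuyang2022, §5.1.2] -/
theorem isUnit_natCast_padicInt_of_not_dvd {n' : ℕ} (hn' : ¬ p ∣ n') : IsUnit ((n' : ℤ_[p])) := by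
  rw [PadicInt.isUnit_iff]
  refine le_antisymm (PadicInt.norm_le_one _) (not_lt.1 fun h => hn' ?_)
  have h' := (PadicInt.norm_int_lt_one_iff_dvd (p := p) (n' : ℤ)).1 (by rwa [Int.cast_natCast])
  exact_mod_cast h'

omit [CharZero F] in
/-- ★ **`logTerm y n ∈ Λ(n − k − e, k)`** for `y ∈ (p, ξ)`, `n = p^e n'` with `p ∤ n'` and `k + e ≤ n`: the `n`-th term of the logarithm
is `p`-adically small modulo `Fil^k`, at a rate beating the denominator `n`. [cite: FontaineAsterisque223III, Exp. II §1.5.3–1.5.4] -/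
theorem logTerm_mem_lattice {y : Ainf (p := p) F} (hy : y ∈ Ideal.span {(p : Ainf (p := p) F), xi}) {n k e n' : ℕ}
    (hn : n = p ^ e * n') (hn' : ¬ p ∣ n') (hke : k + e ≤ n) :
    ∃ (a : Ainf (p := p) F) (w : BDeRhamPlus (integerC F) p),
      logTerm y n = ainfToBdR ((p : Ainf (p := p) F) ^ (n - k - e) * a) + xiBdR ^ k * w := by
  obtain ⟨b, c, hbc⟩ := exists_pow_eq_of_mem_span_p_xi hy (show k ≤ n by omega)
  obtain ⟨v, hv⟩ := isUnit_natCast_padicInt_of_not_dvd (p := p) hn'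
  -- the coefficient `(−1)^{n+1}/n = g · p^{−e}` with `g = (−1)^{n+1} v⁻¹ ∈ ℤ_p`
  set g : ℤ_[p] := (-1) ^ (n + 1) * ↑v⁻¹ with hg
  have hp0 : (p : ℚ_[p]) ≠ 0 := Nat.cast_ne_zero.2 (Fact.out : p.Prime).ne_zero
  have hcoef : ((-1 : ℚ_[p]) ^ (n + 1)) / (n : ℚ_[p]) * (p : ℚ_[p]) ^ (n - k) = (g : ℚ_[p]) * (p : ℚ_[p]) ^ (n - k - e) := by
    have hvv : ((v : ℤ_[p]) : ℚ_[p]) * ((↑v⁻¹ : ℤ_[p]) : ℚ_[p]) = 1 := by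
      rw [← PadicInt.coe_mul, Units.mul_inv, PadicInt.coe_one]
    have hA0 : ((v : ℤ_[p]) : ℚ_[p]) ≠ 0 := fun h0 => by rw [h0, zero_mul] at hvv; exact zero_ne_one hvv
    have hB : (((v⁻¹ : ℤ_[p]ˣ) : ℤ_[p]) : ℚ_[p]) = (((v : ℤ_[p]) : ℚ_[p]))⁻¹ := eq_inv_of_mul_eq_one_right hvv
    have hsplit : (p : ℚ_[p]) ^ (n - k) = (p : ℚ_[p]) ^ e * (p : ℚ_[p]) ^ (n - k - e) := by
      rw [← pow_add]; congr 1; omega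
    have hn1 : (n : ℚ_[p]) = (p : ℚ_[p]) ^ e * ((v : ℤ_[p]) : ℚ_[p]) := by rw [hn, hv]; push_cast; rfl
    rw [hsplit, hg, PadicInt.coe_mul, PadicInt.coe_pow, PadicInt.coe_neg, PadicInt.coe_one, hB, hn1]
    field_simp
  refine ⟨zpToAinf g * b, qpToBdR (((-1 : ℚ_[p]) ^ (n + 1)) / (n : ℚ_[p])) * ainfToBdR c, ?_⟩
  have hq : qpToBdR (((-1 : ℚ_[p]) ^ (n + 1)) / (n : ℚ_[p])) * (p : BDeRhamPlus (integerC F) p) ^ (n - k) =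
      ainfToBdR ((p : Ainf (p := p) F) ^ (n - k - e) * zpToAinf g) := by
    rw [← map_natCast (qpToBdR (F := F) (p := p)) p, ← map_pow, ← map_mul, hcoef, map_mul, map_pow, map_natCast,
      qpToBdR_coe]
    simp only [map_mul, map_pow, map_natCast]
    ring
  rw [logTerm, ← map_pow, hbc, map_add, map_mul, map_mul, map_pow, map_natCast, map_pow, ainfToBdR_xi, mul_add,
    ← mul_assoc, hq]
  simp only [map_mul, map_pow, map_natCast]
  ring

/-! ## §3 The partial sums are lattice-Cauchy -/

omit [CharZero F] [Fact (¬ IsUnit (p : integerC F))] [IsAdicComplete (Ideal.span {(p : integerC F)}) (integerC F)]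
  [ValuativeRel F] [TopologicalSpace F] [IsNonarchimedeanLocalField F] [Fact p.Prime] in
/-- `2·v_p(n) ≤ n`: the `p`-adic valuation grows at most logarithmically. [folklore] -/
private theorem two_mul_le_of_pow_dvd {q e n : ℕ} (hq : 2 ≤ q) (hn : n ≠ 0) (h : q ^ e ∣ n) : 2 * e ≤ n := by
  have h2 : ∀ m : ℕ, 2 * m ≤ 2 ^ m := by
    intro m
    rcases m with _ | m
    · simp
    · have hm := Nat.lt_two_pow_self (n := m)
      rw [pow_succ]
      omega
  have h1 : 2 ^ e ≤ n := (Nat.pow_le_pow_left hq e).trans (Nat.le_of_dvd (Nat.pos_of_ne_zero hn) h)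
  exact (h2 e).trans h1

omit [CharZero F] in
/-- Each term beyond `2(j + k)` lies in `Λ(j, k)`. [cite: FontaineAsterisque223III, Exp. II §1.5.4] -/
theorem logTerm_mem_lattice_of_lt {y : Ainf (p := p) F} (hy : y ∈ Ideal.span {(p : Ainf (p := p) F), xi}) {j k n : ℕ}
    (hn : 2 * (j + k) < n) :
    ∃ (a : Ainf (p := p) F) (w : BDeRhamPlus (integerC F) p),
      logTerm y n = ainfToBdR ((p : Ainf (p := p) F) ^ j * a) + xiBdR ^ k * w := by
  have hn0 : n ≠ 0 := by omega
  obtain ⟨e, n', hn', hne⟩ := Nat.exists_eq_pow_mul_and_not_dvd hn0 p (Fact.out : p.Prime).one_lt.ne'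
  have he : 2 * e ≤ n := two_mul_le_of_pow_dvd (Fact.out : p.Prime).two_le hn0 ⟨n', hne⟩
  obtain ⟨a, w, h⟩ := logTerm_mem_lattice (k := k) hy hne hn' (by omega)
  exact lattice_mono (show j ≤ n - k - e by omega) le_rfl h

omit [CharZero F] in
/-- ★ **The partial sums are lattice-Cauchy**: `P_N(y) − P_M(y) ∈ Λ(j, k)` whenever `2(j + k) < M + 1`, `M ≤ N`.
[cite: FontaineAsterisque223III, Exp. II §1.5.3–1.5.4] -/
theorem logPartialSum_sub_mem_lattice {y : Ainf (p := p) F} (hy : y ∈ Ideal.span {(p : Ainf (p := p) F), xi}) {j k M N : ℕ}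
    (hM : 2 * (j + k) ≤ M) (hMN : M ≤ N) :
    ∃ (a : Ainf (p := p) F) (w : BDeRhamPlus (integerC F) p),
      logPartialSum y N - logPartialSum y M = ainfToBdR ((p : Ainf (p := p) F) ^ j * a) + xiBdR ^ k * w := by
  induction N, hMN using Nat.le_induction with
  | base => exact ⟨0, 0, by simp⟩
  | succ N hMN ih =>
    obtain ⟨a, w, h⟩ := ih
    obtain ⟨a', w', h'⟩ := logTerm_mem_lattice_of_lt hy (j := j) (k := k) (n := N + 1) (by omega)
    refine ⟨a + a', w + w', ?_⟩
    rw [logPartialSum_succ, show logPartialSum y N + logTerm y (N + 1) - logPartialSum y M =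
      (logPartialSum y N - logPartialSum y M) + logTerm y (N + 1) by ring]
    exact lattice_add h h'

/-! ## §4 `log(1 + y)` modulo `Fil^k`: existence, uniqueness, `Γ_F`-equivariance, consistency -/

/-- **`L` is a logarithm of `1 + y` modulo `Fil^k B_dR⁺`**: `P_M(y) → L` for Fontaine's `p`-adic topology on `B_dR⁺/Fil^k`, i.e. for
every `j`, `L − P_M(y) ∈ Λ(j, k) = p^j ι(𝔸_inf) + ξ^k B_dR⁺` for all large `M`. [cite: FontaineAsterisque223III, Exp. II §1.5.4] -/
def IsLogModFil (k : ℕ) (y : Ainf (p := p) F) (L : BDeRhamPlus (integerC F) p) : Prop :=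
  ∀ j : ℕ, ∃ M₀ : ℕ, ∀ M : ℕ, M₀ ≤ M → ∃ (a : Ainf (p := p) F) (w : BDeRhamPlus (integerC F) p),
    L - logPartialSum y M = ainfToBdR ((p : Ainf (p := p) F) ^ j * a) + xiBdR ^ k * w

/-- ★ **Existence**: for `y ∈ (p, ξ)𝔸_inf` and every `k` there is a logarithm of `1 + y` modulo `Fil^k` (completeness of
`B_dR⁺/Fil^k`, `exists_lim_of_forall_sub_mem_lattice`, applied to the subsequence `P_{2(j+k)}`).
[cite: FontaineAsterisque223III, Exp. II §1.5.3–1.5.4] [cite: FontaineOuyang2022, §5.1.2] -/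
theorem exists_isLogModFil {y : Ainf (p := p) F} (hy : y ∈ Ideal.span {(p : Ainf (p := p) F), xi}) (k : ℕ) :
    ∃ L : BDeRhamPlus (integerC F) p, IsLogModFil k y L := by
  -- the subsequence `x j = P_{2(j+k)}` is lattice-Cauchy at the rate `Λ(j, k)`
  obtain ⟨L, r, hL⟩ := exists_lim_of_forall_sub_mem_lattice (x := fun j => logPartialSum y (2 * (j + k))) (k := k)
    (fun N => logPartialSum_sub_mem_lattice hy le_rfl (by omega))
  refine ⟨L, fun j => ⟨2 * (j + r + k), fun M hM => ?_⟩⟩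
  obtain ⟨a, w, h1⟩ := hL j (j + r) le_rfl
  obtain ⟨a', w', h2⟩ := logPartialSum_sub_mem_lattice hy (j := j + r) (k := k) (le_refl (2 * (j + r + k))) hM
  obtain ⟨a'', w'', h3⟩ := lattice_mono (show j ≤ j + r by omega) le_rfl h2
  refine ⟨a - a'', w - w'', ?_⟩
  have e : L - logPartialSum y M = (L - logPartialSum y (2 * (j + r + k))) -
      (logPartialSum y M - logPartialSum y (2 * (j + r + k))) := by ring
  rw [e]
  exact lattice_sub h1 h3

/-- ★ **Uniqueness modulo `Fil^k`**: two logarithms of `1 + y` modulo `Fil^k` differ by an element of `ξ^k B_dR⁺`.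
[cite: FontaineAsterisque223III, Exp. II §1.5.3] -/
theorem IsLogModFil.sub_mem_span_xiBdR_pow {k : ℕ} {y : Ainf (p := p) F} {L L' : BDeRhamPlus (integerC F) p}
    (hL : IsLogModFil k y L) (hL' : IsLogModFil k y L') : L - L' ∈ Ideal.span {(xiBdR : BDeRhamPlus (integerC F) p) ^ k} := by
  refine sub_mem_span_xiBdR_pow_of_forall_lattice_lim (x := logPartialSum y) fun N => ?_
  obtain ⟨M₀, h⟩ := hL N
  obtain ⟨M₀', h'⟩ := hL' N
  obtain ⟨a, w, h1⟩ := h (max M₀ M₀') (le_max_left _ _)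
  obtain ⟨a', w', h2⟩ := h' (max M₀ M₀') (le_max_right _ _)
  exact ⟨max M₀ M₀', a, w, h1, a', w', h2⟩

omit [CharZero F] in
/-- `σ(P_N(y)) = P_N(σ y)`. [cite: FontaineAsterisque223III, Exp. II §1.5.4] -/
theorem galBdRPlus_logPartialSum [CharZero F] (σ : absoluteGaloisGroup F) (y : Ainf (p := p) F) (N : ℕ) :
    galBdRPlus σ (logPartialSum y N) = logPartialSum (galAinf σ y) N := by
  simp only [logPartialSum, logTerm, map_sum, map_mul, map_pow, galBdRPlus_qpToBdR, galBdRPlus_ainfToBdR]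

/-- `Γ_F` preserves `(p, ξ)𝔸_inf` (`σ(ξ) ∈ ker θ = ξ𝔸_inf`). [cite: FontaineAsterisque223III, Exp. II §1.3] -/
theorem galAinf_mem_span_p_xi (σ : absoluteGaloisGroup F) {y : Ainf (p := p) F}
    (hy : y ∈ Ideal.span {(p : Ainf (p := p) F), xi}) : galAinf σ y ∈ Ideal.span {(p : Ainf (p := p) F), xi} := by
  rw [Ideal.mem_span_pair] at hy ⊢
  obtain ⟨a, b, rfl⟩ := hy
  have hξ : galAinf σ xi ∈ Ideal.span {(xi : Ainf (p := p) F)} := by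
    rw [← ker_fontaineTheta_eq_span_xi]
    exact galAinf_mem_ker_fontaineTheta σ xi_mem_ker
  obtain ⟨d, hd⟩ := Ideal.mem_span_singleton'.1 hξ
  refine ⟨galAinf σ a, galAinf σ b * d, ?_⟩
  rw [map_add, map_mul, map_mul, map_natCast, ← hd]; ring

/-- **`Γ_F`-equivariance**: if `L` is a logarithm of `1 + y` modulo `Fil^k` then `σ L` is one of `1 + σ y` (`σ` preserves the
lattices). [cite: FontaineAsterisque223III, Exp. II §1.5.4] -/
theorem IsLogModFil.galBdRPlus {k : ℕ} {y : Ainf (p := p) F} {L : BDeRhamPlus (integerC F) p} (hL : IsLogModFil k y L)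
    (σ : absoluteGaloisGroup F) : IsLogModFil k (galAinf σ y) (galBdRPlus σ L) := by
  intro j
  obtain ⟨M₀, h⟩ := hL j
  refine ⟨M₀, fun M hM => ?_⟩
  obtain ⟨a, w, h1⟩ := h M hM
  obtain ⟨w', hw'⟩ := exists_galBdRPlus_xiBdR_pow_mul σ k w
  refine ⟨galAinf σ a, w', ?_⟩
  rw [← galBdRPlus_logPartialSum, ← map_sub, h1, map_add, galBdRPlus_ainfToBdR, hw', map_mul, map_pow, map_natCast]

/-- ★ **Consistency with the `ξ`-adic logarithm**: for `y ∈ ξ𝔸_inf` (where the series ALSO converges `ξ`-adically) the tree's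
`BdRPlusTop.logOneAdd (ι y)` is a logarithm of `1 + y` modulo every `Fil^k` (`log(1+ιy) − L_N(ιy) ∈ ξ^{N+1}B_dR⁺ ⊆ Λ(j, k)` for `N + 1 ≥ k`).
[cite: FontaineAsterisque223III, Exp. II §1.5.4] -/
theorem isLogModFil_logOneAdd (k : ℕ) {y : Ainf (p := p) F} (hy : y ∈ Ideal.span {(xi : Ainf (p := p) F)}) :
    IsLogModFil k y ((BdRPlusTop.of F p).symm
      (BdRPlusTop.logOneAdd ⟨BdRPlusTop.ofAinf F p y, BdRPlusTop.ofAinf_mem_filOne hy⟩ : BdRPlusTop F p)) := by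
  intro j
  refine ⟨k, fun M hM => ?_⟩
  have h := BdRPlusTop.logOneAdd_sub_aeval_logTrunc_mem (⟨BdRPlusTop.ofAinf F p y, BdRPlusTop.ofAinf_mem_filOne hy⟩ :
    (BdRPlusTop.filOne F p).toIdeal) M
  rw [BdRPlusTop.mem_filOne_pow_iff, map_sub, RingEquiv.symm_apply_apply] at h
  obtain ⟨c, hc⟩ := Ideal.mem_span_singleton'.1 (Ideal.span_singleton_pow (xiBdR : BDeRhamPlus (integerC F) p) (M + 1) ▸ h)
  refine ⟨0, xiBdR ^ (M + 1 - k) * c, ?_⟩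
  rw [logPartialSum_eq_aeval_logTrunc, mul_zero, map_zero, zero_add, ← mul_assoc, ← pow_add, Nat.add_sub_cancel' (by omega),
    mul_comm, hc]
  rfl

end GaloisContinuity

end Literature.NumberTheory.PAdicHodge

end
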